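/-
Copyright (c) 2026 the pub-hodgecm-mathlib formalisation cell (harness21).  Prover seat hodgecm-mathlib-K2Liu-p11 (g2), Track B «K2-LIT»,
#184♮ = hLiu418 = `stmt-HodgeConjecture-24832`; A7-val road (σ) (K2Liu-p09 (g6) memo `REPORT-FIRST-A7val-PaperFirst` §3 V6), LEAD F0P6-plan (g14)
BATCH #5 «V6 `K2LiuIkedaFunctionalAverage` = K2Liu-p11 (g2)»; file V6a = THE GENERIC HALF (V6-inst pins the K2Liu instance later).
THEOREMS ONLY (no `def`, no `instance`, no notation, no named-fact hypothesis, no `sorry`).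
-/
import Summits.HodgeConjecture.HodgeConjecture.Theorems.K2LiuIwasawaAverageInvariant   -- ★ A2b: the `K`-average of a `(P, Δ_P)`-equivariant functional is `G`-invariant
import HarnessLib

/-!
# Crux `HLiu418`, A7-val (σ), V6a: THE `K′`-AVERAGE `B̄` OF A SECTION-VALUED FUNCTIONAL `B` — linearity, the value on `K′`-fixed vectors,
# `G`-invariance (Iwasawa), and transport of every law of `B` through the average

Cell `hodgecm-mathlib`, crux item hLiu418 = `stmt-HodgeConjecture-24832` (helper lane `--supports`, count-neutral).

GENERIC SETTING (instance, V6-inst ∕ V8: `G = U(V′_v)`, `P = P′_v = Stab(X′)`, `K = K′_v`, `V = 𝒮`, `ω = leviOp ∘ ρ`, `H = H_v = U(W)(F_v)`,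
`B Φ = sw_{a′}(r_v Φ)` the Kudla–Rallis ∕ Ikeda functional): `G` a locally compact second countable group with subgroups `P` (closed) and `K` (compact
open), `μK` a Haar measure on `↥K`; `ω : G →* End_ℂ(V)` a representation; `B : V →ₗ[ℂ] (H → ℂ)` a SECTION-VALUED linear map.  The average is written
EXPLICITLY, `B̄ Φ h := ∫ k : ↥K, B (ω k Φ) h ∂μK` (no definition is introduced):
* §1 `integrable_coeff_of_continuous` (smooth vectors), **`exists_linearMap_average`** — `B̄` IS a linear map `V →ₗ[ℂ] (H → ℂ)`;
* §2 **`average_eq_of_forall_fixed`** — (i) on `K`-fixed vectors `B̄ Φ h = μK(K) · B Φ h`; `measureReal_univ_pos` (`0 < μK(K) < ∞`),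
  **`average_ne_zero_of_fixed`** — (iv) `B Φ₀ h ≠ 0 ⇒ B̄ Φ₀ h ≠ 0` for `K`-fixed `Φ₀` (instance: `Φ₀ = 𝟙_{lattice}`, ★ β-2 `krFun_indicator_pi`);
* §3 **`average_mul_eq_average`** — (ii) `B̄ (ω g Φ) = B̄ Φ` for ALL `g ∈ G` when `B` is `(P, Δ_P)`-equivariant, `G = P·K`, `G` unimodular (★ A2b at
  `ℓ := ev_h ∘ B`); `isMulRightInvariant_haar_subgroup`, `average_mul_eq_average_of_mem` — `K`-invariance for free;
* §4 **`average_law`** — (iii) TRANSPORT: for `A : V →ₗ V` commuting with `ω(K)` and a law `B (A Ψ) h = c · B Ψ h′` (all `Ψ`), the average obeys the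
  same law `B̄ (A Φ) h = c · B̄ Φ h′` — `H`-equivariance, the `I(−½)` Siegel law, `N_Δ`-invariance of `B` all pass to `B̄` through this one lemma
  (their instances are (L2) ∕ ★ S4-law business, nothing of them is imported here); `average_law_add` (laws with two terms).
References: [Bump1997, Prop. 2.1.5, §2.6]; [GanQiuTakeda2014, §2.7–2.8 (the `K`-projection in front of the Ikeda map)]; [Ichino2004, §1];
[CartierCorvallis1979, §III.3].
HONEST LABEL: HC_CM is proved only modulo the 7 printed citations (2 remaining named inputs: hLiu418 = stmt-HodgeConjecture-24832,
h413 = stmt-HodgeConjecture-24833) until rung 0 closes; count-neutral helper, closes no socket.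
-/

set_option autoImplicit false
set_option linter.dupNamespace false

noncomputable section

open MeasureTheory MeasureTheory.Measure Set Filter Topology Function
open scoped NNReal ENNReal

namespace Summit.HodgeConjecture.HodgeConjecture.Cruxes.HLiu418.K2LiuIkedaFunctionalAverage

open Literature.MeasureTheory.Group
open Summit.HodgeConjecture.HodgeConjecture.Cruxes.HLiu418.K2LiuIwasawaAverageInvariant

universe u

variable {G : Type u} [Group G] [TopologicalSpace G] [IsTopologicalGroup G] [LocallyCompactSpace G] [T2Space G] [SecondCountableTopology G]
  [MeasurableSpace G] [BorelSpace G] {P K : Subgroup G}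
variable {V : Type*} [AddCommGroup V] [Module ℂ V] {H : Type*}

/-! ## §1  The average is a linear map -/

omit [IsTopologicalGroup G] [LocallyCompactSpace G] [T2Space G] [SecondCountableTopology G] in
/-- **smooth vectors have integrable coefficients on `K`**: if `x ↦ B(ω x Φ) h` is continuous on `G` and `K` is compact, the coefficient is
`μK`-integrable on `↥K`. [Bump1997, §2.6] -/
theorem integrable_coeff_of_continuous (hK : IsCompact (K : Set G)) (μK : Measure ↥K) [IsFiniteMeasureOnCompacts μK]
    (ω : G →* (V →ₗ[ℂ] V)) (B : V →ₗ[ℂ] (H → ℂ)) (Φ : V) (h : H) (hcont : Continuous fun x : G => B (ω x Φ) h) :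
    Integrable (fun k : ↥K => B (ω (k : G) Φ) h) μK := by
  haveI : CompactSpace ↥K := isCompact_iff_compactSpace.1 hK
  exact (hcont.comp continuous_subtype_val).integrable_of_hasCompactSupport (HasCompactSupport.of_compactSpace _)

omit [TopologicalSpace G] [IsTopologicalGroup G] [LocallyCompactSpace G] [T2Space G] [SecondCountableTopology G] [BorelSpace G] in
/-- **THE AVERAGE `B̄` IS LINEAR**: if every coefficient `k ↦ B(ω k Φ) h` is integrable on `K`, there is a (unique) linear `B̄ : V →ₗ[ℂ] (H → ℂ)` with
`B̄ Φ h = ∫_K B(ω k Φ) h dμK`. [Bump1997, §2.6] [GanQiuTakeda2014, §2.7] -/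
theorem exists_linearMap_average (μK : Measure ↥K) (ω : G →* (V →ₗ[ℂ] V)) (B : V →ₗ[ℂ] (H → ℂ))
    (hint : ∀ (Φ : V) (h : H), Integrable (fun k : ↥K => B (ω (k : G) Φ) h) μK) :
    ∃ Bbar : V →ₗ[ℂ] (H → ℂ), ∀ (Φ : V) (h : H), Bbar Φ h = ∫ k : ↥K, B (ω (k : G) Φ) h ∂μK := by
  refine ⟨{ toFun := fun Φ h => ∫ k : ↥K, B (ω (k : G) Φ) h ∂μK, map_add' := fun Φ Ψ => ?_, map_smul' := fun c Φ => ?_ }, fun Φ h => rfl⟩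
  · funext h
    simp only [map_add, Pi.add_apply]
    exact integral_add (hint Φ h) (hint Ψ h)
  · funext h
    simp only [map_smul, Pi.smul_apply, smul_eq_mul, RingHom.id_apply]
    exact integral_const_mul c _

/-! ## §2  The value on `K`-fixed vectors; non-vanishing -/

omit [TopologicalSpace G] [IsTopologicalGroup G] [LocallyCompactSpace G] [T2Space G] [SecondCountableTopology G] [BorelSpace G] in
/-- **(i) ON `K`-FIXED VECTORS `B̄ = μK(K) · B`**: if `ω k Φ = Φ` for all `k ∈ K` then `∫_K B(ω k Φ) h dμK = μK(K) · B Φ h`. [GanQiuTakeda2014, §2.7] -/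
theorem average_eq_of_forall_fixed (μK : Measure ↥K) (ω : G →* (V →ₗ[ℂ] V)) (B : V →ₗ[ℂ] (H → ℂ)) {Φ : V}
    (hfix : ∀ k : ↥K, ω (k : G) Φ = Φ) (h : H) :
    ∫ k : ↥K, B (ω (k : G) Φ) h ∂μK = (μK.real univ : ℂ) * B Φ h := by
  simp_rw [hfix]
  rw [integral_const, Complex.real_smul]

omit [IsTopologicalGroup G] [LocallyCompactSpace G] [T2Space G] [SecondCountableTopology G] [BorelSpace G] in
/-- `0 < μK(K)` (as a real number) for a Haar measure on the compact open subgroup `K`. [Bump1997, §2.6] -/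
theorem measureReal_univ_pos (hK : IsCompact (K : Set G)) (μK : Measure ↥K) [IsHaarMeasure μK] : 0 < μK.real univ := by
  haveI : CompactSpace ↥K := isCompact_iff_compactSpace.1 hK
  exact ENNReal.toReal_pos (IsOpenPosMeasure.open_pos _ isOpen_univ univ_nonempty) (measure_lt_top μK _).ne

omit [IsTopologicalGroup G] [LocallyCompactSpace G] [T2Space G] [SecondCountableTopology G] [BorelSpace G] in
/-- **(iv) NON-VANISHING ON A `K`-FIXED VECTOR**: `ω(K) Φ₀ = Φ₀` and `B Φ₀ h ≠ 0` ⇒ `B̄ Φ₀ h ≠ 0` (instance: `Φ₀ = 𝟙_{lattice}`, `K = K′` its stabiliser,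
`B Φ₀ 1 ≠ 0` by ★ β-2 `krFun_indicator_pi`). [GanQiuTakeda2014, §2.8] -/
theorem average_ne_zero_of_fixed (hK : IsCompact (K : Set G)) (μK : Measure ↥K) [IsHaarMeasure μK] (ω : G →* (V →ₗ[ℂ] V))
    (B : V →ₗ[ℂ] (H → ℂ)) {Φ : V} (hfix : ∀ k : ↥K, ω (k : G) Φ = Φ) {h : H} (hne : B Φ h ≠ 0) :
    ∫ k : ↥K, B (ω (k : G) Φ) h ∂μK ≠ 0 := by
  rw [average_eq_of_forall_fixed μK ω B hfix h]
  exact mul_ne_zero (by exact_mod_cast (measureReal_univ_pos hK μK).ne') hne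

/-! ## §3  `G`-invariance (Iwasawa) and `K`-invariance -/

variable [LocallyCompactSpace ↥P]

/-- **(ii) THE AVERAGE IS `G`-INVARIANT**: `G` unimodular second countable, `P` closed, `K` compact open, `G = P·K`; if `B` is `(P, Δ_P)`-EQUIVARIANT
(`B (ω p Φ) h = Δ_P(p) · B Φ h`, `Δ_P` = Mathlib's `modularCharacter` of `↥P`) and the coefficient `x ↦ B(ω x Φ) h` is continuous, then
**`∫_K B(ω k (ω g Φ)) h dμK = ∫_K B(ω k Φ) h dμK`** for every `g ∈ G` — ★ A2b `integral_apply_mul_eq_integral_apply` at `ℓ := ev_h ∘ B`.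
[Bump1997, Prop. 2.1.5] [GanQiuTakeda2014, §2.7–2.8] [CartierCorvallis1979, §III.3] -/
theorem average_mul_eq_average (hP : IsClosed (P : Set G)) (hK : IsCompact (K : Set G)) (hKo : IsOpen (K : Set G))
    (hPK : ∀ g : G, ∃ p ∈ P, ∃ k ∈ K, g = p * k) (μG : Measure G) [IsHaarMeasure μG] [μG.IsMulRightInvariant]
    (μP : Measure ↥P) [IsHaarMeasure μP] (μK : Measure ↥K) [IsHaarMeasure μK]
    (ω : G →* (V →ₗ[ℂ] V)) (B : V →ₗ[ℂ] (H → ℂ)) (h : H)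
    (hB : ∀ (p : ↥P) (Φ : V), B (ω (p : G) Φ) h = (((modularCharacter p : ℝ≥0) : ℝ) : ℂ) * B Φ h)
    (Φ : V) (hcont : Continuous fun x : G => B (ω x Φ) h) (g : G) :
    ∫ k : ↥K, B (ω (k : G) (ω g Φ)) h ∂μK = ∫ k : ↥K, B (ω (k : G) Φ) h ∂μK :=
  integral_apply_mul_eq_integral_apply hP hK hKo hPK μG μP μK ω ((LinearMap.proj h).comp B) (fun p v => hB p v) Φ hcont g

omit [LocallyCompactSpace ↥P] in
/-- A Haar measure on the compact subgroup `↥K` is RIGHT-invariant (compact groups are unimodular). [Folland1995, §2.4 Prop. 2.27] -/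
theorem isMulRightInvariant_haar_subgroup (hK : IsCompact (K : Set G)) (μK : Measure ↥K) [IsHaarMeasure μK] : μK.IsMulRightInvariant := by
  haveI : CompactSpace ↥K := isCompact_iff_compactSpace.1 hK
  haveI : LocallyCompactSpace ↥K := hK.isClosed.isClosedEmbedding_subtypeVal.locallyCompactSpace
  haveI : SecondCountableTopology ↥K := TopologicalSpace.Subtype.secondCountableTopology (K : Set G)
  refine ⟨fun k => map_mul_right_eq_self_of_mem_isCompact μK ⊤ ?_ (Subgroup.mem_top k)⟩
  simpa using isCompact_univ (X := ↥K)

omit [TopologicalSpace G] [IsTopologicalGroup G] [LocallyCompactSpace G] [T2Space G] [SecondCountableTopology G] [BorelSpace G]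
  [LocallyCompactSpace ↥P] in
/-- **`K`-INVARIANCE FOR FREE**: `∫_K B(ω k (ω k₀ Φ)) h dμK = ∫_K B(ω k Φ) h dμK` for `k₀ ∈ K` (right-invariance of `μK`; no Iwasawa hypothesis).
[Folland1995, §2.4 Cor. 2.28] -/
theorem average_mul_eq_average_of_mem [MeasurableMul ↥K] (μK : Measure ↥K) [μK.IsMulRightInvariant] (ω : G →* (V →ₗ[ℂ] V))
    (B : V →ₗ[ℂ] (H → ℂ)) (Φ : V) (h : H) (k₀ : ↥K) :
    ∫ k : ↥K, B (ω (k : G) (ω (k₀ : G) Φ)) h ∂μK = ∫ k : ↥K, B (ω (k : G) Φ) h ∂μK := by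
  have h1 : ∀ k : ↥K, B (ω (k : G) (ω (k₀ : G) Φ)) h = (fun κ : ↥K => B (ω (κ : G) Φ) h) (k * k₀) := fun k => by
    simp only [Subgroup.coe_mul, map_mul, Module.End.mul_apply]
  simp_rw [h1]
  exact integral_mul_right_eq_self (fun κ : ↥K => B (ω (κ : G) Φ) h) k₀

/-! ## §4  Transport of laws through the average -/

omit [TopologicalSpace G] [IsTopologicalGroup G] [LocallyCompactSpace G] [T2Space G] [SecondCountableTopology G] [BorelSpace G]
  [LocallyCompactSpace ↥P] in
/-- **(iii) LAW TRANSPORT.**  Let `A : V →ₗ V` commute with `ω(K)` and let `B` obey the law `B (A Ψ) h = c · B Ψ h′` for all `Ψ` (fixed `h, h′, c`).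
Then the average obeys the same law: **`∫_K B(ω k (A Φ)) h dμK = c · ∫_K B(ω k Φ) h′ dμK`**.  Instances: `H`-equivariance (`A = ω_H(h₀)`, `c = 1`,
`h′ = h·h₀`), the `I(−½)` Siegel-parabolic law of `B` (`A` = the `P_Δ`-operator, `c` = its character value), `N_Δ`-invariance (`c = 1`, `h′ = h`).
[GanQiuTakeda2014, §2.8] [Ichino2004, §1] -/
theorem average_law (μK : Measure ↥K) (ω : G →* (V →ₗ[ℂ] V)) (B : V →ₗ[ℂ] (H → ℂ)) (A : V →ₗ[ℂ] V)
    (hA : ∀ (k : ↥K) (Ψ : V), A (ω (k : G) Ψ) = ω (k : G) (A Ψ)) {h h' : H} {c : ℂ} (hlaw : ∀ Ψ : V, B (A Ψ) h = c * B Ψ h') (Φ : V) :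
    ∫ k : ↥K, B (ω (k : G) (A Φ)) h ∂μK = c * ∫ k : ↥K, B (ω (k : G) Φ) h' ∂μK := by
  have h1 : ∀ k : ↥K, B (ω (k : G) (A Φ)) h = c * B (ω (k : G) Φ) h' := fun k => by rw [← hA, hlaw]
  simp_rw [h1]
  exact integral_const_mul c _

omit [TopologicalSpace G] [IsTopologicalGroup G] [LocallyCompactSpace G] [T2Space G] [SecondCountableTopology G] [BorelSpace G]
  [LocallyCompactSpace ↥P] in
/-- **LAW TRANSPORT, pointwise-in-`K` form**: it suffices that the law holds along the `K`-orbit of `Φ` (`B (A (ω k Φ)) h = c · B (ω k Φ) h′` for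
`k ∈ K`). [GanQiuTakeda2014, §2.8] -/
theorem average_law_of_orbit (μK : Measure ↥K) (ω : G →* (V →ₗ[ℂ] V)) (B : V →ₗ[ℂ] (H → ℂ)) (A : V →ₗ[ℂ] V)
    (hA : ∀ (k : ↥K) (Ψ : V), A (ω (k : G) Ψ) = ω (k : G) (A Ψ)) {h h' : H} {c : ℂ} (Φ : V)
    (hlaw : ∀ k : ↥K, B (A (ω (k : G) Φ)) h = c * B (ω (k : G) Φ) h') :
    ∫ k : ↥K, B (ω (k : G) (A Φ)) h ∂μK = c * ∫ k : ↥K, B (ω (k : G) Φ) h' ∂μK := by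
  have h1 : ∀ k : ↥K, B (ω (k : G) (A Φ)) h = c * B (ω (k : G) Φ) h' := fun k => by rw [← hA, hlaw]
  simp_rw [h1]
  exact integral_const_mul c _

omit [TopologicalSpace G] [IsTopologicalGroup G] [LocallyCompactSpace G] [T2Space G] [SecondCountableTopology G] [BorelSpace G]
  [LocallyCompactSpace ↥P] in
/-- **LAW TRANSPORT WITH TWO TERMS** (e.g. an intertwining identity `B (A Ψ) h = c₁ · B Ψ h₁ + c₂ · B Ψ h₂`), under integrability of the coefficients.
[GanQiuTakeda2014, §2.8] -/
theorem average_law_add (μK : Measure ↥K) (ω : G →* (V →ₗ[ℂ] V)) (B : V →ₗ[ℂ] (H → ℂ)) (A : V →ₗ[ℂ] V)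
    (hA : ∀ (k : ↥K) (Ψ : V), A (ω (k : G) Ψ) = ω (k : G) (A Ψ)) {h h₁ h₂ : H} {c₁ c₂ : ℂ}
    (hlaw : ∀ Ψ : V, B (A Ψ) h = c₁ * B Ψ h₁ + c₂ * B Ψ h₂) (Φ : V)
    (hint₁ : Integrable (fun k : ↥K => B (ω (k : G) Φ) h₁) μK) (hint₂ : Integrable (fun k : ↥K => B (ω (k : G) Φ) h₂) μK) :
    ∫ k : ↥K, B (ω (k : G) (A Φ)) h ∂μK = c₁ * ∫ k : ↥K, B (ω (k : G) Φ) h₁ ∂μK + c₂ * ∫ k : ↥K, B (ω (k : G) Φ) h₂ ∂μK := by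
  have h1 : ∀ k : ↥K, B (ω (k : G) (A Φ)) h = c₁ * B (ω (k : G) Φ) h₁ + c₂ * B (ω (k : G) Φ) h₂ := fun k => by rw [← hA, hlaw]
  simp_rw [h1]
  rw [integral_add (hint₁.const_mul c₁) (hint₂.const_mul c₂), integral_const_mul, integral_const_mul]

omit [TopologicalSpace G] [IsTopologicalGroup G] [LocallyCompactSpace G] [T2Space G] [SecondCountableTopology G] [BorelSpace G]
  [LocallyCompactSpace ↥P] in
/-- **VANISHING TRANSPORT**: if `B` kills a `ω(K)`-stable class of vectors (`S` with `ω k S ⊆ S`), so does the average — e.g. (N′) «supported off the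
null cone» or «vanishing near the vertex» classes of V2∕V5, which are `K′`-stable. [BernsteinZelevinsky1976, §1.5] -/
theorem average_eq_zero_of_stable (μK : Measure ↥K) (ω : G →* (V →ₗ[ℂ] V)) (B : V →ₗ[ℂ] (H → ℂ)) (S : Set V)
    (hS : ∀ (k : ↥K), ∀ Ψ ∈ S, ω (k : G) Ψ ∈ S) {h : H} (hB : ∀ Ψ ∈ S, B Ψ h = 0) {Φ : V} (hΦ : Φ ∈ S) :
    ∫ k : ↥K, B (ω (k : G) Φ) h ∂μK = 0 := by
  have h1 : ∀ k : ↥K, B (ω (k : G) Φ) h = 0 := fun k => hB _ (hS k Φ hΦ)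
  simp_rw [h1]
  exact integral_zero ↥K ℂ

end Summit.HodgeConjecture.HodgeConjecture.Cruxes.HLiu418.K2LiuIkedaFunctionalAverage

end
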